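import Summits.NavierStokesRegularity.NavierStokesRegularity.Theses.SwallowedContinuum
import Literature.Analysis.FluidPDE.SuitableWeak
import HarnessLib.Audit

/-!
# Birth skeleton (BC3) of crux `NoDiscSwallow` (route SwallowedContinuum, rank 2)

Crux item `stmt-NavierStokesRegularity-17612`; tree path `Cruxes/NoDiscSwallow/Lines/birth.lean`;
registrar `planner-skel-stmt-NavierStokesRegularity-17612-0`, 2026-08-17 (route re-audit bin HONEST: the
route was opened 2026-08-17T02:03Z with a birth skeleton attached only as item evidence — this file
registers it in the crux workfile tree).

THE CRUX (K1, "no membrane is swallowed"). For `ν, T > 0`, every classical solution `(u,p)` of unforced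
NS on `ℝ³ × [0,T)` that is Leray–Hopf on `[0,T]` from a rapidly decaying datum, every flow map `X` of `u`
on `[0,T)` (`X 0 = id`, `∂ₛ X(s,a) = u(s, X(s,a))` within `[0,T)`) and every uniform limit `Xs` of
`X(t,·)` as `t ↑ T`: no fibre `Xs⁻¹{x}` contains an embedded closed 2-disc
(`ContinuousOn φ ∧ InjOn φ ∧ MapsTo φ` on `closedBall (0 : ℝ²) 1`).

THE CUT — LOCALISE, THEN SPLIT BY RATE (the route's own foreseen first layer-2 move, TWO-LAYER PLAN:
"each sector K ⇐ K_TypeI → K_notTypeI → K, split by the in-tree rate predicate `IsTypeIBlowup u T`",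
preceded by the route's support item `RegularFibreTrivial`, which removes every fibre over a point
near which `u` stays bounded up to `T`). Write `Reg(x) :≡ ∃ r > 0, ∃ M, ∀ t ∈ [T − r², T), ∀ y ∈ B(x,r),
‖u t y‖ ≤ M` (the literal hypothesis of `RegularFibreTrivial`; only times `t < T` are read, so no junk
values of `u` after `T` enter).

* `stub_regularFibreTrivial` [provable-now; = route support item `RegularFibreTrivial`
  (stmt-NavierStokesRegularity-17617) VERBATIM — certified below by `regularFibreTrivial_item_iff_stub :
  … ↔ … := Iff.rfl`]. Over a point `x` with `Reg(x)` the fibre `Xs⁻¹{x}` is a subsingleton (interior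
  regularity makes `u` Lipschitz up to `T` near `x`; backward ODE uniqueness through the common endpoint).
  It needs the analytic hypotheses: `Disproof.noDiscSwallow_false_without_NS` (bounded, non-Lipschitz
  collapse `u = −y/(1−t)` on a shrinking ball) swallows a disc over a point with `Reg`, so boundedness of
  `u` alone does not freeze fibres — the stub keeps `IsClassicalNSSolutionOn`/`IsLerayHopfOn`/decay.
* `stub_noDiscSwallow_typeI` [open, L–XL; the Type-I sector]. Same binders as the crux plus
  `IsTypeIBlowup u T` (`‖u(t)‖_∞ ≤ C/√(T−t)` eventually as `t ↑ T`) and `¬ Reg(x)`: no disc in `Xs⁻¹{x}`.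
  Reading (route header): in Leray similarity variables at `(T,x)` the swallowed set is the bounded-forward-
  orbit set of `ẏ = U(y,s) + y/2`, `div = 3/2`, so a swallowed disc is a 2-dimensional stable set of a
  bounded invariant set of a Type-I tangent flow — a Liouville statement about the STAGNATION STRUCTURE of
  Type-I profiles (KNSS2009, SereginSverak2009: axisymmetric Type I excluded; the disc sector there is empty).
  Why it might fail: non-symmetric Type-I (DSS) profiles are not excluded and nothing forbids a saddle-type
  profile with a 2-dimensional stable manifold through the blow-up point.
* `stub_noDiscSwallow_notTypeI` [open-problem; the tornado]. Same binders plus `¬ IsTypeIBlowup u T` and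
  `¬ Reg(x)`: no disc in `Xs⁻¹{x}`. This is Hou's interior axisymmetric scenario (arXiv:2107.06509): the
  equatorial disc swallowed at Type-II rate; Kelvin on membrane loops + viscous leakage through a shrinking
  perimeter is the only mechanism on offer (route header, why-it-might-fail of the crux).

COMPOSITION (real proof, this file): `NoDiscSwallow_of : Theses.SwallowedContinuum.NoDiscSwallow` — the
ONLY theorem here concluding the crux, BY NAME, no hypotheses; it uses the three stubs by name: fix the
binders and a point `x`; if `Reg(x)` then the route item `RegularFibreTrivial` (obtained from
`stub_regularFibreTrivial` through `regularFibreTrivial_item_iff_stub`) makes the fibre a subsingleton, and an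
embedded disc has two distinct points `φ 0 ≠ φ e₀` in it (`two_points`, injectivity on the closed ball) —
contradiction; if `¬ Reg(x)`, case on `IsTypeIBlowup u T` and apply the matching sector stub.
A sorry-free curried twin `NoDiscSwallow_of_stubs : ‹stub₁› → ‹stub₂› → ‹stub₃› → NoDiscSwallow` is kept
in the registrar's evidence file `NoDiscSwallow_birth_closed.lean` (not here: a second theorem concluding
the crux would compete for the skeleton slot of `#h21_check_skeleton`).

DISPROOF USED (`Cruxes/NoDiscSwallow/Disproof.lean`, refuter-rattack-…-17612-0): every stub keeps ALL of
the crux's binders, so the line honours `noDiscSwallow_false_without_ode/_init/_limit` (flow clauses kept in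
all three stubs) and `noDiscSwallow_false_without_NS` (analytic clauses kept; they are used at
`stub_regularFibreTrivial` — see above — and at both sector stubs); `crux_at_restState` /
`hypotheses_restState` inhabit the binders of stubs 1–2 (rest state: `Reg` everywhere, Type I trivially),
so neither is vacuous; no `Negative/` lemma has landed for this crux (nothing to be an instance of).
-/

noncomputable section

open Set Filter Topology
open Literature.Analysis.FluidPDE

namespace Summit.NavierStokesRegularity.NavierStokesRegularity.Cruxes.NoDiscSwallow.Birth

set_option linter.unusedVariables false
-- `<Problem> = <Summit>` duplicates `NavierStokesRegularity` in every name (lakefile sets this weakly).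
set_option linter.dupNamespace false

local notation "ℝ³" => EuclideanSpace ℝ (Fin 3)
local notation "ℝ²" => EuclideanSpace ℝ (Fin 2)

/-! ### The three declared stubs (the ONLY placeholders in this file) -/

/-- **stub 1 — `stub_regularFibreTrivial`** (provable now; verbatim the route's support item
`Theses.SwallowedContinuum.RegularFibreTrivial`, stmt-NavierStokesRegularity-17617): under the crux's
binders, over a point `x` near which `u` stays bounded up to `T` from below
(`∃ r > 0, ∃ M, ∀ t ∈ [T − r², T), ∀ y ∈ B(x,r), ‖u t y‖ ≤ M`) the fibre `Xs⁻¹{x}` has at most one label.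
Sources: doi:10.1088/0951-7715/22/9/002, CaffarelliKohnNirenberg1982, LemarieRieusset2016. -/
theorem stub_regularFibreTrivial :
    ∀ (ν T : ℝ), 0 < ν → 0 < T → ∀ (u : ℝ → EuclideanSpace ℝ (Fin 3) → EuclideanSpace ℝ (Fin 3))
    (p : ℝ → EuclideanSpace ℝ (Fin 3) → ℝ),
    Literature.Analysis.FluidPDE.IsClassicalNSSolutionOn (Set.Ico 0 T) ν 0 u p →
    Literature.Analysis.FluidPDE.IsLerayHopfOn T ν 0 (u 0) u →
    Literature.Analysis.FluidPDE.HasRapidSpatialDecay (u 0) →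
    ∀ (X : ℝ → EuclideanSpace ℝ (Fin 3) → EuclideanSpace ℝ (Fin 3))
    (Xs : EuclideanSpace ℝ (Fin 3) → EuclideanSpace ℝ (Fin 3)), (∀ a, X 0 a = a) →
    (∀ a, ∀ t ∈ Set.Ico 0 T, HasDerivWithinAt (fun s => X s a) (u t (X t a)) (Set.Ico 0 T) t) →
    TendstoUniformly X Xs (nhdsWithin T (Set.Iio T)) →
    ∀ x : EuclideanSpace ℝ (Fin 3),
    (∃ r > 0, ∃ M : ℝ, ∀ t ∈ Set.Ico (T - r ^ 2) T, ∀ y ∈ Metric.ball x r, ‖u t y‖ ≤ M) →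
    (Xs ⁻¹' {x}).Subsingleton := by
  sorry

/-- **stub 2 — `stub_noDiscSwallow_typeI`** (open; the Type-I sector of K1): under the crux's binders,
if the blow-up rate at `T` is Type I (`IsTypeIBlowup u T`) then no fibre over a point `x` near which `u`
is unbounded up to `T` contains an embedded closed 2-disc. Sources: KNSS2009, SereginSverak2009, Tao2011;
why it might fail: a non-symmetric (DSS) Type-I profile with a saddle-type stagnation point and a
2-dimensional stable set is not excluded by anything in print. -/
theorem stub_noDiscSwallow_typeI :
    ∀ (ν T : ℝ), 0 < ν → 0 < T → ∀ (u : ℝ → EuclideanSpace ℝ (Fin 3) → EuclideanSpace ℝ (Fin 3))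
    (p : ℝ → EuclideanSpace ℝ (Fin 3) → ℝ),
    Literature.Analysis.FluidPDE.IsClassicalNSSolutionOn (Set.Ico 0 T) ν 0 u p →
    Literature.Analysis.FluidPDE.IsLerayHopfOn T ν 0 (u 0) u →
    Literature.Analysis.FluidPDE.HasRapidSpatialDecay (u 0) →
    Literature.Analysis.FluidPDE.IsTypeIBlowup u T →
    ∀ (X : ℝ → EuclideanSpace ℝ (Fin 3) → EuclideanSpace ℝ (Fin 3))
    (Xs : EuclideanSpace ℝ (Fin 3) → EuclideanSpace ℝ (Fin 3)), (∀ a, X 0 a = a) →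
    (∀ a, ∀ t ∈ Set.Ico 0 T, HasDerivWithinAt (fun s => X s a) (u t (X t a)) (Set.Ico 0 T) t) →
    TendstoUniformly X Xs (nhdsWithin T (Set.Iio T)) →
    ∀ x : EuclideanSpace ℝ (Fin 3),
    (¬ ∃ r > 0, ∃ M : ℝ, ∀ t ∈ Set.Ico (T - r ^ 2) T, ∀ y ∈ Metric.ball x r, ‖u t y‖ ≤ M) →
    ¬ ∃ φ : EuclideanSpace ℝ (Fin 2) → EuclideanSpace ℝ (Fin 3),
      ContinuousOn φ (Metric.closedBall 0 1) ∧ Set.InjOn φ (Metric.closedBall 0 1) ∧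
        Set.MapsTo φ (Metric.closedBall 0 1) (Xs ⁻¹' {x}) := by
  sorry

/-- **stub 3 — `stub_noDiscSwallow_notTypeI`** (open-problem; the tornado / Hou sector of K1): under
the crux's binders, if the rate at `T` is NOT Type I (`¬ IsTypeIBlowup u T`) then no fibre over a point
`x` near which `u` is unbounded up to `T` contains an embedded closed 2-disc. Sources:
Hou2022PotentiallySingularNS, arXiv:2107.06509, LuoHou2014, Tao2011; why it might fail: this is exactly
Hou's interior axisymmetric candidate, which swallows the equatorial disc at Type-II rate. -/
theorem stub_noDiscSwallow_notTypeI :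
    ∀ (ν T : ℝ), 0 < ν → 0 < T → ∀ (u : ℝ → EuclideanSpace ℝ (Fin 3) → EuclideanSpace ℝ (Fin 3))
    (p : ℝ → EuclideanSpace ℝ (Fin 3) → ℝ),
    Literature.Analysis.FluidPDE.IsClassicalNSSolutionOn (Set.Ico 0 T) ν 0 u p →
    Literature.Analysis.FluidPDE.IsLerayHopfOn T ν 0 (u 0) u →
    Literature.Analysis.FluidPDE.HasRapidSpatialDecay (u 0) →
    ¬ Literature.Analysis.FluidPDE.IsTypeIBlowup u T →
    ∀ (X : ℝ → EuclideanSpace ℝ (Fin 3) → EuclideanSpace ℝ (Fin 3))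
    (Xs : EuclideanSpace ℝ (Fin 3) → EuclideanSpace ℝ (Fin 3)), (∀ a, X 0 a = a) →
    (∀ a, ∀ t ∈ Set.Ico 0 T, HasDerivWithinAt (fun s => X s a) (u t (X t a)) (Set.Ico 0 T) t) →
    TendstoUniformly X Xs (nhdsWithin T (Set.Iio T)) →
    ∀ x : EuclideanSpace ℝ (Fin 3),
    (¬ ∃ r > 0, ∃ M : ℝ, ∀ t ∈ Set.Ico (T - r ^ 2) T, ∀ y ∈ Metric.ball x r, ‖u t y‖ ≤ M) →
    ¬ ∃ φ : EuclideanSpace ℝ (Fin 2) → EuclideanSpace ℝ (Fin 3),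
      ContinuousOn φ (Metric.closedBall 0 1) ∧ Set.InjOn φ (Metric.closedBall 0 1) ∧
        Set.MapsTo φ (Metric.closedBall 0 1) (Xs ⁻¹' {x}) := by
  sorry

/-! ### Sorry-free glue -/

/-- Stub 1 is LITERALLY the route's support item `RegularFibreTrivial` (definitional `Iff.rfl`): proving
item stmt-NavierStokesRegularity-17617 discharges `stub_regularFibreTrivial` and conversely. -/
theorem regularFibreTrivial_item_iff_stub :
    Theses.SwallowedContinuum.RegularFibreTrivial ↔
    (∀ (ν T : ℝ), 0 < ν → 0 < T → ∀ (u : ℝ → EuclideanSpace ℝ (Fin 3) → EuclideanSpace ℝ (Fin 3))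
    (p : ℝ → EuclideanSpace ℝ (Fin 3) → ℝ),
    Literature.Analysis.FluidPDE.IsClassicalNSSolutionOn (Set.Ico 0 T) ν 0 u p →
    Literature.Analysis.FluidPDE.IsLerayHopfOn T ν 0 (u 0) u →
    Literature.Analysis.FluidPDE.HasRapidSpatialDecay (u 0) →
    ∀ (X : ℝ → EuclideanSpace ℝ (Fin 3) → EuclideanSpace ℝ (Fin 3))
    (Xs : EuclideanSpace ℝ (Fin 3) → EuclideanSpace ℝ (Fin 3)), (∀ a, X 0 a = a) →
    (∀ a, ∀ t ∈ Set.Ico 0 T, HasDerivWithinAt (fun s => X s a) (u t (X t a)) (Set.Ico 0 T) t) →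
    TendstoUniformly X Xs (nhdsWithin T (Set.Iio T)) →
    ∀ x : EuclideanSpace ℝ (Fin 3),
    (∃ r > 0, ∃ M : ℝ, ∀ t ∈ Set.Ico (T - r ^ 2) T, ∀ y ∈ Metric.ball x r, ‖u t y‖ ≤ M) →
    (Xs ⁻¹' {x}).Subsingleton) :=
  Iff.rfl

/-- Two distinct points of the closed unit 2-disc: its centre and `e₀`. -/
theorem two_points : (0 : ℝ²) ∈ Metric.closedBall (0 : ℝ²) 1 ∧
    EuclideanSpace.single (0 : Fin 2) (1 : ℝ) ∈ Metric.closedBall (0 : ℝ²) 1 ∧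
    (0 : ℝ²) ≠ EuclideanSpace.single (0 : Fin 2) (1 : ℝ) := by
  refine ⟨by simp, by simp, ?_⟩
  intro h
  have := congrArg (fun v : ℝ² => v 0) h
  simp at this

/-- A subsingleton contains no embedded closed 2-disc (an embedding separates `0` and `e₀`). -/
theorem not_disc_of_subsingleton {A : Set ℝ³} (hA : A.Subsingleton) :
    ¬ ∃ φ : ℝ² → ℝ³, ContinuousOn φ (Metric.closedBall 0 1) ∧ Set.InjOn φ (Metric.closedBall 0 1) ∧
      Set.MapsTo φ (Metric.closedBall 0 1) A := by
  rintro ⟨φ, -, hinj, hmaps⟩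
  obtain ⟨h0, h1, hne⟩ := two_points
  exact hne (hinj h0 h1 (hA (hmaps h0) (hmaps h1)))

/-! ### The composition (real proof; concludes the crux BY NAME, no hypotheses) -/

/-- **The skeleton theorem.** `NoDiscSwallow` from the three declared stubs, by pure logic: localise at
the endpoint `x` (regular ⇒ subsingleton fibre ⇒ no disc; singular ⇒ split by the Type-I rate predicate). -/
theorem NoDiscSwallow_of : Theses.SwallowedContinuum.NoDiscSwallow := by
  intro ν T hν hT u p hcl hLH hdec X Xs h0 hode hlim x
  by_cases hreg : ∃ r > 0, ∃ M : ℝ, ∀ t ∈ Set.Ico (T - r ^ 2) T, ∀ y ∈ Metric.ball x r, ‖u t y‖ ≤ M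
  · -- regular endpoint: the route item `RegularFibreTrivial` (fed by stub 1, by name) makes the fibre
    -- a subsingleton, which swallows no disc
    have hitem : Theses.SwallowedContinuum.RegularFibreTrivial :=
      regularFibreTrivial_item_iff_stub.mpr stub_regularFibreTrivial
    exact not_disc_of_subsingleton (hitem ν T hν hT u p hcl hLH hdec X Xs h0 hode hlim x hreg)
  · -- singular endpoint: split by the blow-up rate at `T`
    by_cases hI : Literature.Analysis.FluidPDE.IsTypeIBlowup u T
    · exact stub_noDiscSwallow_typeI ν T hν hT u p hcl hLH hdec hI X Xs h0 hode hlim x hreg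
    · exact stub_noDiscSwallow_notTypeI ν T hν hT u p hcl hLH hdec hI X Xs h0 hode hlim x hreg

end Summit.NavierStokesRegularity.NavierStokesRegularity.Cruxes.NoDiscSwallow.Birth

end
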